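import Summits.QuantumFields.YangMills.Theorems.BalabanUVNodesN18TorusDomainCover
import Summits.QuantumFields.YangMills.Theorems.BalabanUVNodesN18AdmTransportPlaqSmall
import HarnessLib

/-!
# BalabanUVNodes ∕ node N18 = NE5 — closure-ledger item (iii), the REAL leg: AN ADMISSIBLE BACKGROUND OF RUN B IS PLAQUETTE-SMALL, AND ITS TRANSPORT OF RECORD IS
# PLAQUETTE-SMALL WITH THE PRINT's FIRST-ORDER-EXACT RADIUS `L²α₀ + C₀(L²α₀)²` ([Balaban1985Averaging] Prop. 1 (51), sharp) — the (1.11)∕(1.14) plaquette letter of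
# `T₀U` at run A from membership in the table of record alone (Track A, DAG node N18 = `T4OutputRate.NE5` :211; cluster K4 «SpineRates», item K3⁷
# `SpineGivenEndpointR13SepCoPH`; seat pub-ymgap-dag-n18-w3 g3)

HONEST FRAMING.  Count-neutral kernel bookkeeping (`--supports stmt-QuantumFields-20544 --as helper`): composition BY NAME of this seat's FILE 5 (`plaqBound_of_forall_mem_spaceOfRecord`:
space membership ⇒ plaquette box, through an arbitrary complex gauge, by C⋆-normality), FILE 6 (`plaqCover_domSys`: the whole torus is a domain, its cubes cover every
site) and dag-n18-d's module 13 (`YMDAG.N18.W1Reading.plaqSmall_transportRaw_avOfRecord_sharp` = dag-n21-c's SHARP Prop. 1 `BlockAveragingEMLProp2.plaqSmall_blockAvg_eml_sharp`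
at the transport of record).  This is the REAL-LEG plaquette letter only (the background clause `hT₀`'s (1.11) content at run A's TOP level); the complex leg of (L1), the
(1.12) gauge clause and the letters `a, a₁, δ₀, δ₁, s₀, s₁` are NOT here; nothing of Bałaban's RG asserted; NE5 NOT PRINTED ∕ NOT proved; N18 NOT discharged; nothing
about the continuum ∕ OS ∕ mass gap ∕ Clay.

WHAT.
* ★ `plaqSmall_of_forall_mem_spaceOfRecord` — a run-B background `U` whose reading `(ιU, 0)` lies in the table of record `W1.spaceOfRecord Sg Rz α₀ α₁ j Y` at EVERY
  `(j, Y)` (`0 < M`) is `PlaqSmall (α₀ 0) U`: every plaquette within run B's TOP radius of `1`.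
* ★★ `plaqSmall_transportRaw_of_forall_mem_spaceOfRecord` — hence its transport of record `transportRaw F k (avOfRecord F N (k+1) 0) U` is
  `PlaqSmall (L²·α₀(0) + 143·((((d+4)L)²∕4)·α₀(0))²)` (`0 < α₀(0)`, chart guard `(((d+4)L)²∕4)·α₀(0) ≤ δ_N∕2`) — [B7] (51)'s `L²α₀ + C₀(L²α₀)²`, the first-order-EXACT step
  of the radius (`α₀′ = α₀(1 + C₀α₀ξ′²)` in coarse units), compatible with the level-geometric slack of the radii family L; and the crude-constant edition
  `…_crude` (`(L² + 6((d+2)L)²)·α₀(0)`, guard `(((d+2)L)²∕4)·α₀(0) < δ_N`) for completeness.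

0 `def`, 0 `sorry`.  References: T. Bałaban, CMP **98** (1985) 17–51 [Balaban1985Averaging] (Prop. 1 (51) p.26); CMP **109** (1987) 249–301 [Balaban1987RG1] ((0.4) p.253,
(0.18) p.255, (1.11)–(1.16) p.262).
-/

noncomputable section

open Set
open scoped Matrix.Norms.L2Operator

namespace YMDAG.N18.TransportOfRecord

open Literature.MathematicalPhysics.QuantumFieldTheory.Balaban1983to89
open Literature.MathematicalPhysics.QuantumFieldTheory.Balaban1983to89.T4Continuum
open Literature.MathematicalPhysics.QuantumFieldTheory.Balaban1983to89.Node00 (MatA ιSU plaqInside)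
open Literature.MathematicalPhysics.QuantumFieldTheory.Balaban1983to89.Node00.Sect2 (domSys domSites CPair ofBackgroundC spaceI frameI Setting Residual)
open Literature.MathematicalPhysics.QuantumFieldTheory.Balaban1983to89.Node00.W1 (spaceOfRecord)
open Literature.MathematicalPhysics.QuantumFieldTheory.Balaban1983to89.ExpMeanLog (deltaSU)
open Summit.QuantumFields.BalabanUV.T4Continuum.B13Carriers (transportRaw)
open YMDAG.N18.W1Reading (plaqSmall_transportRaw_avOfRecord plaqSmall_transportRaw_avOfRecord_sharp)

section RealLeg

variable {N : ℕ} [NeZero N]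

/-- ★ **AN ADMISSIBLE BACKGROUND OF RUN B IS PLAQUETTE-SMALL AT ITS TOP RADIUS**: if `(ιU, 0)` lies in the table of record at every `(j, Y)` (settings `Sg`, any residual
recipe `Rz`, radii `α₀, α₁ : ℕ → ℝ`) and `0 < M`, then `dist1 (U(∂p)) < α₀ 0` at EVERY plaquette `p` — FILE 5 (membership ⇒ box, through the complex gauge) at the
whole-torus domain of FILE 6 (`j = 0`, `η_0 = 1`). [cite: Balaban1987RG1, (1.14) p.262, p.257 (localization domains)] -/
theorem plaqSmall_of_forall_mem_spaceOfRecord {P : Params} (Sg : Setting (MatA N) (Node00.SU N)) (Rz : Residual P (MatA N)) {M : ℕ} (hM : 0 < M)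
    (α₀ α₁ : ℕ → ℝ) {U : GaugeField P 0 (Node00.SU N)}
    (hU : ∀ (j : ℕ) (Y : (domSys P M j).Dom), ofBackgroundC (ιSU N) U ∈ spaceOfRecord (M := M) Sg Rz α₀ α₁ j Y) :
    PlaqSmall (α₀ 0) U :=
  plaqBound_of_forall_mem_spaceOfRecord Sg Rz α₀ α₁ (plaqCover_domSys hM α₀) hU

variable (F : T4Family) (N) (M k : ℕ)

/-- ★★ **THE TRANSPORT OF RECORD OF AN ADMISSIBLE BACKGROUND IS PLAQUETTE-SMALL WITH THE PRINT's RADIUS `L²α₀ + C₀(L²α₀)²`** ([Balaban1985Averaging] Prop. 1 (51),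
SHARP — dag-n21-c's `plaqSmall_blockAvg_eml_sharp` through dag-n18-d's module 13): for a run-B background `U` in the table of record at every `(j, Y)`, `0 < M`,
`0 < α₀(k+1)(0)` and the chart guard `(((d+4)L)²∕4)·α₀(k+1)(0) ≤ δ_N∕2`:
`PlaqSmall (L²·α₀(k+1)(0) + 143·((((d+4)L)²∕4)·α₀(k+1)(0))²) (transportRaw F k (avOfRecord F N (k+1) 0) U)`.
[cite: Balaban1985Averaging, Prop. 1 (51) p.26; Balaban1987RG1, (0.4) p.253 and (1.11) p.262] -/
theorem plaqSmall_transportRaw_of_forall_mem_spaceOfRecord (Sg : ℕ → Setting (MatA N) (Node00.SU N)) (α₀ α₁ : ℕ → ℕ → ℝ) (hM : 0 < M)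
    (ha : 0 < α₀ (k + 1) 0)
    (hguard : ((((F.P (k + 1)).d + 4) * (F.P (k + 1)).L : ℕ) : ℝ) ^ 2 / 4 * α₀ (k + 1) 0 ≤ deltaSU (Fin N) / 2)
    {U : GaugeField (F.P (k + 1)) 0 (Node00.SU N)}
    (hU : ∀ (j : ℕ) (Y : (domSys (F.P (k + 1)) M j).Dom),
      ofBackgroundC (ιSU N) U ∈ spaceOfRecord (M := M) (Sg (k + 1)) (Residual.unit (F.P (k + 1)) (MatA N)) (α₀ (k + 1)) (α₁ (k + 1)) j Y) :
    PlaqSmall (((F.P (k + 1)).L : ℝ) ^ 2 * α₀ (k + 1) 0 + 143 * (((((F.P (k + 1)).d + 4) * (F.P (k + 1)).L : ℕ) : ℝ) ^ 2 / 4 * α₀ (k + 1) 0) ^ 2)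
      (transportRaw F k (Node00.avOfRecord F N (k + 1) 0) U) :=
  plaqSmall_transportRaw_avOfRecord_sharp k ha hguard (plaqSmall_of_forall_mem_spaceOfRecord (Sg (k + 1)) _ hM (α₀ (k + 1)) (α₁ (k + 1)) hU)

/-- The crude-constant edition (`(L² + 6((d+2)L)²)·α₀(k+1)(0)`, guard `(((d+2)L)²∕4)·α₀(k+1)(0) < δ_N`; module 13's `plaqSmall_transportRaw_avOfRecord`).
[cite: Balaban1985Averaging, Prop. 1 (51) p.26; Balaban1987RG1, (0.4) p.253] -/
theorem plaqSmall_transportRaw_of_forall_mem_spaceOfRecord_crude (Sg : ℕ → Setting (MatA N) (Node00.SU N)) (α₀ α₁ : ℕ → ℕ → ℝ) (hM : 0 < M)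
    (ha : 0 ≤ α₀ (k + 1) 0)
    (hguard : ((((F.P (k + 1)).d + 2) * (F.P (k + 1)).L : ℕ) : ℝ) ^ 2 / 4 * α₀ (k + 1) 0 < deltaSU (Fin N))
    {U : GaugeField (F.P (k + 1)) 0 (Node00.SU N)}
    (hU : ∀ (j : ℕ) (Y : (domSys (F.P (k + 1)) M j).Dom),
      ofBackgroundC (ιSU N) U ∈ spaceOfRecord (M := M) (Sg (k + 1)) (Residual.unit (F.P (k + 1)) (MatA N)) (α₀ (k + 1)) (α₁ (k + 1)) j Y) :
    PlaqSmall ((((F.P (k + 1)).L : ℝ) ^ 2 + 6 * ((((F.P (k + 1)).d + 2) * (F.P (k + 1)).L : ℕ) : ℝ) ^ 2) * α₀ (k + 1) 0)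
      (transportRaw F k (Node00.avOfRecord F N (k + 1) 0) U) :=
  plaqSmall_transportRaw_avOfRecord k ha hguard (plaqSmall_of_forall_mem_spaceOfRecord (Sg (k + 1)) _ hM (α₀ (k + 1)) (α₁ (k + 1)) hU)

end RealLeg

end YMDAG.N18.TransportOfRecord

end
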